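import Literature.Geometry.Symplectic.SphereProdSymplecticForm
import Literature.Geometry.Manifold.ModelChange
import Literature.Topology.FourManifolds.SphereProductCohomology
import Mathlib.Geometry.Manifold.LocalDiffeomorph
import HarnessLib

/-!
# `S² × S²` as a closed simply connected symplectic 4-manifold charted on `ℝ⁴`, with its
# square-zero symplectic spheres (the "rational host" package)

Topic `Literature/Geometry/Symplectic`.  Third brick after `SphereAreaForm.lean` (the area form
`σ` of the round `S²`, McDuff–Salamon 2017 Example 3.1.2) and `SphereProdSymplecticForm.lean`
(`σ ⊕ σ` on Mathlib's product manifold `S² × S²`, modelled on `ℝ² × ℝ²`, with its symplectic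
slices `S² × {q}`; McDuff–Salamon §3.1 p. 106, Example 10.4.2 (iii)).  Statements about symplectic
4-manifolds in the tree quantify over manifolds charted on ONE model `ℝ⁴ = EuclideanSpace ℝ (Fin 4)`
with the model with corners `𝓡 4` (e.g. the host clause of the line `stable-seam-host` of
`Summit.SmoothPoincare4.…OrigamiFoldExistence`, or `Stabilisation.StabOneSuffices`, which produces
a `P` charted on `ℝ⁴` with a diffeomorphism `P ≃ₘ⟮𝓡 4, (𝓡 2).prod (𝓡 2)⟯ S² × S²`).  This file
TRANSPORTS the package `(σ ⊕ σ; S² × {q}, S² × {q'})` to any such manifold: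

* `pullback_nondegenerate_of_bijective_mfderiv`, `isSymplectic_pullback_diffeomorph` — general
  (any real models): the pull-back of a smooth closed non-degenerate 2-form along a `C^∞`
  diffeomorphism is smooth, closed and non-degenerate (Warner 2.22–2.23 as discharged in the tree —
  `isSmoothForm_pullback`, `mextDeriv_pullback` — and bijectivity of the differential of a
  diffeomorphism, Mathlib's `Diffeomorph.mfderivToContinuousLinearEquiv`); McDuff–Salamon 2017,
  §3.1 (symplectomorphisms `ψ^*ω' = ω`).
* For `X` charted on `ℝ⁴` and `Φ : X ≃ₘ⟮𝓡 4, (𝓡 2).prod (𝓡 2)⟯ S² × S²`: the transported form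
  `hostFormOfDiffeo Φ = Φ^*(σ ⊕ σ)` (symplectic: `hostFormOfDiffeo_isSymplectic`) and slices
  `hostSliceOfDiffeo Φ q = Φ⁻¹ ∘ (·, q)` — `C^∞`, injective with injective differential
  (`mfderiv_hostSliceOfDiffeo`), hence smooth embeddings of the compact `S²`
  (`isSmoothEmbedding_hostSliceOfDiffeo`, tree theorem
  `isSmoothEmbedding_of_injective_of_injective_mfderiv`), SYMPLECTIC
  (`hostFormOfDiffeo_hostSlice : (Φ^*(σ ⊕ σ))(dc v, dc w) = σ(v, w)`, by functoriality of the
  pull-back `MForm.pullback_comp` and `Φ ∘ Φ⁻¹ = id`), pairwise disjoint for `q ≠ q'` and all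
  homotopic (through `Φ⁻¹ ∘ (·, γ t)` for a path `γ` in the path-connected `S²`);
  `sphereProd_hostPackage_of_diffeomorph` assembles these in the shape of the tree's clauses.
* The MODEL: `SphereProdFour = Rechart f (S² × S²)`, Mathlib's product manifold re-charted on `ℝ⁴`
  along `ℝ² × ℝ² ≃L ℝ⁴` (tree construction `Literature.Geometry.Manifold.Rechart`, Lee 2013
  Prop. 1.17, exactly as in `Literature.Barriers.SmoothPoincare4.exists_sphereProd_model`), a
  compact Hausdorff second-countable simply connected `C^∞` 4-manifold charted on `ℝ⁴` with the
  identity diffeomorphism `sphereProdFourDiffeo : SphereProdFour ≃ₘ S² × S²`; whence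
  `sphereProdFour_hostPackage`: **`(S² × S², σ ⊕ σ)` charted on `ℝ⁴` is a closed simply connected
  symplectic 4-manifold carrying a symplectic embedded 2-sphere `S² × {q}` with a disjoint
  homotopic embedded push-off `S² × {-q}`** (square zero; McDuff–Salamon Example 13.4.2).

Everything is proved; no named facts.

## References

* [McDuffSalamon2017] D. McDuff, D. Salamon, *Introduction to Symplectic Topology*, 3rd ed.,
  OUP (2017), §3.1 p. 106, Example 10.4.2 (iii), Example 13.4.2 (`S² × S²`).
* [LeeSmoothManifolds2013] J. M. Lee, *Introduction to Smooth Manifolds*, 2nd ed. (2013),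
  Prop. 1.17 (compatible atlases), Prop. 3.6 (differential of a diffeomorphism).
* [HirschDT1976] M. W. Hirsch, *Differential Topology* (1976), Ch. 1 §3 Thm. 3.1.
-/

noncomputable section

open scoped Manifold ContDiff Topology
open Set Function
open Literature.Geometry.Kaehler

namespace Literature.Geometry.Symplectic

/-- Local notation: `𝔼 n` is the model space `EuclideanSpace ℝ (Fin n)`. -/
local notation "𝔼" n:arg => EuclideanSpace ℝ (Fin n)

/-- Local notation: `𝕊²` is the unit sphere in `ℝ³`. -/
local notation "𝕊²" => (Metric.sphere (0 : EuclideanSpace ℝ (Fin 3)) 1)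

/-! ### Transport of symplectic forms along diffeomorphisms (any models) -/

section Transport

variable {EM : Type*} [NormedAddCommGroup EM] [NormedSpace ℝ EM] {HM : Type*}
  [TopologicalSpace HM] {I : ModelWithCorners ℝ EM HM} {M : Type*} [TopologicalSpace M]
  [ChartedSpace HM M]
  {EN : Type*} [NormedAddCommGroup EN] [NormedSpace ℝ EN] {HN : Type*}
  [TopologicalSpace HN] {J : ModelWithCorners ℝ EN HN} {N : Type*} [TopologicalSpace N]
  [ChartedSpace HN N]

/-- **Non-degeneracy pulls back along maps with bijective differential**: if `df_x` is
bijective for all `x` and the 2-form `s` on `N` is non-degenerate, so is `f^* s`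
(for `v ≠ 0`, `df v ≠ 0` pairs non-trivially with some `w' = df w`). [folklore] -/
theorem pullback_nondegenerate_of_bijective_mfderiv {f : M → N}
    (hf : ∀ x, Bijective (mfderiv I J f x)) {s : MForm J N ℝ 2}
    (hs : ∀ y (v : TangentSpace J y), v ≠ 0 → ∃ w : TangentSpace J y, s y ![v, w] ≠ 0)
    (x : M) (v : TangentSpace I x) (hv : v ≠ 0) :
    ∃ w : TangentSpace I x, s.pullback I f x ![v, w] ≠ 0 := by
  have hv' : mfderiv I J f x v ≠ 0 := fun h => hv ((hf x).1 (by rw [h, map_zero]))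
  obtain ⟨w', hw'⟩ := hs (f x) _ hv'
  obtain ⟨w, rfl⟩ := (hf x).2 w'
  refine ⟨w, ?_⟩
  rw [MForm.pullback_apply]
  convert hw' using 2
  funext i
  fin_cases i <;> rfl

/-- The differential of a `C^∞` diffeomorphism is bijective at every point (Mathlib's
`Diffeomorph.mfderivToContinuousLinearEquiv`; Lee 2013, Prop. 3.6).
[cite: LeeSmoothManifolds2013, Prop. 3.6] -/
theorem bijective_mfderiv_diffeomorph (Φ : M ≃ₘ⟮I, J⟯ N) (x : M) :
    Bijective (mfderiv I J Φ x) :=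
  (Φ.mfderivToContinuousLinearEquiv (by simp) x).bijective

variable [IsManifold I ∞ M] [IsManifold J ∞ N]

/-- **Symplectic forms pull back along diffeomorphisms**: for a `C^∞` diffeomorphism `Φ : M ≅ N`
and a smooth, closed, non-degenerate 2-form `s` on `N`, the form `Φ^* s` is smooth, closed and
non-degenerate (McDuff–Salamon 2017, §3.1: `ψ^*ω` is symplectic; Warner 2.22–2.23 for
`d Φ^* = Φ^* d`). [cite: McDuffSalamon2017, §3.1] -/
theorem isSymplectic_pullback_diffeomorph (Φ : M ≃ₘ⟮I, J⟯ N) {s : MForm J N ℝ 2}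
    (hs : IsSmoothForm s ∧ IsClosedForm s ∧
      ∀ y (v : TangentSpace J y), v ≠ 0 → ∃ w : TangentSpace J y, s y ![v, w] ≠ 0) :
    IsSmoothForm (s.pullback I Φ) ∧ IsClosedForm (s.pullback I Φ) ∧
      ∀ x (v : TangentSpace I x), v ≠ 0 → ∃ w : TangentSpace I x, s.pullback I Φ x ![v, w] ≠ 0 := by
  obtain ⟨h1, h2, h3⟩ := hs
  refine ⟨Literature.NumberTheory.Transcendental.isSmoothForm_pullback Φ.contMDiff h1, ?_,
    pullback_nondegenerate_of_bijective_mfderiv (bijective_mfderiv_diffeomorph Φ) h3⟩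
  have h2' : mextDeriv s = 0 := h2
  rw [IsClosedForm, Literature.NumberTheory.Transcendental.mextDeriv_pullback Φ.contMDiff h1, h2',
    MForm.pullback_zero]

end Transport

section Host

/-- The `Fact` instance feeding Mathlib's sphere API for `S² ⊂ ℝ³`. [folklore] -/
private theorem fact_finrank_three_host : Fact (Module.finrank ℝ (𝔼 3) = 2 + 1) :=
  ⟨finrank_euclideanSpace_fin⟩

/-- The `Fact` instance for `S² ⊂ ℝ³` with the ambient space spelled `ℝ^(2+1)`. [folklore] -/
private theorem fact_finrank_three_host' :
    Fact (Module.finrank ℝ (EuclideanSpace ℝ (Fin (2 + 1))) = 2 + 1) :=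
  ⟨finrank_euclideanSpace_fin⟩

attribute [local instance] fact_finrank_three_host fact_finrank_three_host'

/-- `S²` is path connected (Mathlib's `isPathConnected_sphere`). [folklore] -/
theorem pathConnectedSpace_sphereTwo : PathConnectedSpace 𝕊² := by
  have hrank : 1 < Module.rank ℝ (𝔼 3) := by
    apply Module.one_lt_rank_of_one_lt_finrank
    simp only [finrank_euclideanSpace, Fintype.card_fin]
    omega
  exact isPathConnected_iff_pathConnectedSpace.mp (isPathConnected_sphere hrank 0 zero_le_one)

/-! ### The host package on an `ℝ⁴`-charted copy of `S² × S²` -/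

variable {X : Type*} [TopologicalSpace X] [ChartedSpace (𝔼 4) X]
  (Φ : X ≃ₘ⟮𝓡 4, (𝓡 2).prod (𝓡 2)⟯ (𝕊² × 𝕊²))

/-- The transported symplectic form `Φ^*(σ ⊕ σ)` on `X ≅ S² × S²`.
[cite: McDuffSalamon2017, §3.1 p. 106] -/
def hostFormOfDiffeo : MForm (𝓡 4) X ℝ 2 :=
  sphereProdForm.pullback (𝓡 4) Φ

/-- The transported horizontal slice `Φ⁻¹ ∘ (·, q) : S² → X`. [folklore] -/
def hostSliceOfDiffeo (q : 𝕊²) : 𝕊² → X :=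
  Φ.symm ∘ horizSlice q

/-- `hostSliceOfDiffeo Φ q y = Φ⁻¹ (y, q)`. [folklore] -/
@[simp]
theorem hostSliceOfDiffeo_apply (q y : 𝕊²) : hostSliceOfDiffeo Φ q y = Φ.symm (y, q) := rfl

/-- The transported slices are `C^∞`. [folklore] -/
theorem contMDiff_hostSliceOfDiffeo (q : 𝕊²) :
    ContMDiff (𝓡 2) (𝓡 4) ∞ (hostSliceOfDiffeo Φ q) :=
  Φ.symm.contMDiff.comp (contMDiff_horizSlice q)

/-- The transported slices are injective. [folklore] -/
theorem injective_hostSliceOfDiffeo (q : 𝕊²) : Injective (hostSliceOfDiffeo Φ q) :=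
  (EquivLike.injective Φ.symm).comp (injective_horizSlice q)

/-- The differential of a transported slice: `d(Φ⁻¹ ∘ (·, q))_y v = dΦ⁻¹_{(y, q)} (v, 0)`.
[folklore] -/
theorem mfderiv_hostSliceOfDiffeo (q y : 𝕊²) (v : TangentSpace (𝓡 2) y) :
    mfderiv (𝓡 2) (𝓡 4) (hostSliceOfDiffeo Φ q) y v =
      mfderiv ((𝓡 2).prod (𝓡 2)) (𝓡 4) Φ.symm (horizSlice q y)
        (mfderiv (𝓡 2) ((𝓡 2).prod (𝓡 2)) (horizSlice q) y v) := by
  rw [hostSliceOfDiffeo, mfderiv_comp y (Φ.symm.mdifferentiable (by simp) _)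
    ((contMDiff_horizSlice q).mdifferentiableAt (by simp))]
  rfl

/-- The differential of a transported slice is injective. [folklore] -/
theorem injective_mfderiv_hostSliceOfDiffeo (q y : 𝕊²) :
    Injective (mfderiv (𝓡 2) (𝓡 4) (hostSliceOfDiffeo Φ q) y) := by
  intro v w h
  rw [mfderiv_hostSliceOfDiffeo, mfderiv_hostSliceOfDiffeo] at h
  exact injective_mfderiv_horizSlice q y
    ((bijective_mfderiv_diffeomorph Φ.symm (horizSlice q y)).1 h)

/-- Functoriality: the pull-back of `Φ^*(σ ⊕ σ)` along `Φ⁻¹ ∘ (·, q)` is the pull-back of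
`σ ⊕ σ` along `(·, q)` (`(Φ ∘ Φ⁻¹ ∘ (·, q))^* = (·, q)^*`, `MForm.pullback_comp`). [folklore] -/
theorem pullback_hostFormOfDiffeo_hostSlice (q : 𝕊²) :
    (hostFormOfDiffeo Φ).pullback (𝓡 2) (hostSliceOfDiffeo Φ q) =
      sphereProdForm.pullback (𝓡 2) (horizSlice q) := by
  have hd : MDifferentiable (𝓡 2) (𝓡 4) (hostSliceOfDiffeo Φ q) :=
    (contMDiff_hostSliceOfDiffeo Φ q).mdifferentiable (by simp)
  rw [hostFormOfDiffeo, ← MForm.pullback_comp (Φ.mdifferentiable (by simp)) hd]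
  congr 1
  funext z
  simp [hostSliceOfDiffeo]

/-- **The transported slices are symplectic**: `(Φ^*(σ ⊕ σ))(dc v, dc w) = σ(v, w)` for
`c = Φ⁻¹ ∘ (·, q)`. [cite: McDuffSalamon2017, Example 10.4.2 (iii)] -/
theorem hostFormOfDiffeo_hostSlice (q y : 𝕊²) (v w : TangentSpace (𝓡 2) y) :
    hostFormOfDiffeo Φ (hostSliceOfDiffeo Φ q y)
      ![mfderiv (𝓡 2) (𝓡 4) (hostSliceOfDiffeo Φ q) y v,
        mfderiv (𝓡 2) (𝓡 4) (hostSliceOfDiffeo Φ q) y w] = sphereAreaForm y ![v, w] := by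
  have h1 := congrFun (pullback_hostFormOfDiffeo_hostSlice Φ q) y
  have h2 := DFunLike.congr_fun h1 ![v, w]
  rw [MForm.pullback_apply, MForm.pullback_apply] at h2
  rw [← sphereProdForm_horizSlice q y v w]
  convert h2 using 2 <;> (funext i; fin_cases i <;> rfl)

/-- The transported slices are symplectic spheres: the restricted form is non-degenerate, in
the shape of the tree's clause. [cite: McDuffSalamon2017, Example 10.4.2 (iii)] -/
theorem hostFormOfDiffeo_hostSlice_nondegenerate (q y : 𝕊²) (v : TangentSpace (𝓡 2) y)
    (hv : v ≠ 0) : ∃ w : TangentSpace (𝓡 2) y,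
      hostFormOfDiffeo Φ (hostSliceOfDiffeo Φ q y)
        ![mfderiv (𝓡 2) (𝓡 4) (hostSliceOfDiffeo Φ q) y v,
          mfderiv (𝓡 2) (𝓡 4) (hostSliceOfDiffeo Φ q) y w] ≠ 0 := by
  obtain ⟨w, hw⟩ := sphereAreaForm_nondegenerate y v hv
  exact ⟨w, by rwa [hostFormOfDiffeo_hostSlice]⟩

/-- Distinct transported slices are disjoint. [folklore] -/
theorem disjoint_range_hostSliceOfDiffeo {q q' : 𝕊²} (h : q ≠ q') :
    Disjoint (range (hostSliceOfDiffeo Φ q)) (range (hostSliceOfDiffeo Φ q')) := by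
  rw [hostSliceOfDiffeo, hostSliceOfDiffeo, Set.range_comp, Set.range_comp]
  exact Set.disjoint_image_of_injective (EquivLike.injective Φ.symm) (disjoint_range_horizSlice h)

/-- All transported slices are homotopic: `(t, y) ↦ Φ⁻¹ (y, γ t)` for a path `γ` from `q` to
`q'` in the path-connected `S²`. [folklore] -/
theorem exists_homotopy_hostSliceOfDiffeo (q q' : 𝕊²) :
    ∃ H : unitInterval × 𝕊² → X, Continuous H ∧
      ∀ y, H (0, y) = hostSliceOfDiffeo Φ q y ∧ H (1, y) = hostSliceOfDiffeo Φ q' y := by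
  haveI := pathConnectedSpace_sphereTwo
  let γ : Path q q' := PathConnectedSpace.somePath q q'
  refine ⟨fun p => Φ.symm (p.2, γ p.1), ?_, fun y => ⟨?_, ?_⟩⟩
  · exact Φ.symm.continuous.comp (continuous_snd.prodMk (γ.continuous.comp continuous_fst))
  · simp
  · simp

variable [IsManifold (𝓡 4) ∞ X]

/-- **`Φ^*(σ ⊕ σ)` is a symplectic form** (smooth, closed, non-degenerate).
[cite: McDuffSalamon2017, §3.1 p. 106] -/
theorem hostFormOfDiffeo_isSymplectic :
    IsSmoothForm (hostFormOfDiffeo Φ) ∧ IsClosedForm (hostFormOfDiffeo Φ) ∧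
      ∀ x (v : TangentSpace (𝓡 4) x), v ≠ 0 →
        ∃ w : TangentSpace (𝓡 4) x, hostFormOfDiffeo Φ x ![v, w] ≠ 0 :=
  isSymplectic_pullback_diffeomorph Φ sphereProdForm_isSymplectic

/-- **The transported slices are smooth embeddings** of the compact `S²` into the Hausdorff `X`
(injective immersions; tree theorem `isSmoothEmbedding_of_injective_of_injective_mfderiv`,
Hirsch Ch. 1 §3 Thm. 3.1). [cite: HirschDT1976, Ch. 1 §3 Thm. 3.1] -/
theorem isSmoothEmbedding_hostSliceOfDiffeo [T2Space X] (q : 𝕊²) :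
    Manifold.IsSmoothEmbedding (𝓡 2) (𝓡 4) ∞ (hostSliceOfDiffeo Φ q) :=
  Literature.Topology.FourManifolds.isSmoothEmbedding_of_injective_of_injective_mfderiv
    (contMDiff_hostSliceOfDiffeo Φ q) (by simp) (injective_hostSliceOfDiffeo Φ q)
    (injective_mfderiv_hostSliceOfDiffeo Φ q)

/-- **The host package on `X ≅ S² × S²`** (in the shape of the tree's clauses): for `X` charted
on `ℝ⁴`, Hausdorff, with a diffeomorphism `Φ` onto `S² × S²`, and `q ≠ q'`, the form
`Ω = Φ^*(σ ⊕ σ)` is symplectic and the transported slices `c = Φ⁻¹ ∘ (·, q)`,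
`c' = Φ⁻¹ ∘ (·, q')` are smooth embeddings, `c` is `Ω`-symplectic, their images are disjoint
and they are homotopic. [cite: McDuffSalamon2017, Example 10.4.2 (iii); Example 13.4.2] -/
theorem sphereProd_hostPackage_of_diffeomorph [T2Space X] {q q' : 𝕊²} (hq : q ≠ q') :
    (IsSmoothForm (hostFormOfDiffeo Φ) ∧ IsClosedForm (hostFormOfDiffeo Φ) ∧
      ∀ x (v : TangentSpace (𝓡 4) x), v ≠ 0 →
        ∃ w : TangentSpace (𝓡 4) x, hostFormOfDiffeo Φ x ![v, w] ≠ 0) ∧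
    (Manifold.IsSmoothEmbedding (𝓡 2) (𝓡 4) ∞ (hostSliceOfDiffeo Φ q) ∧
      (∀ y (v : TangentSpace (𝓡 2) y), v ≠ 0 → ∃ w : TangentSpace (𝓡 2) y,
        hostFormOfDiffeo Φ (hostSliceOfDiffeo Φ q y)
          ![mfderiv (𝓡 2) (𝓡 4) (hostSliceOfDiffeo Φ q) y v,
            mfderiv (𝓡 2) (𝓡 4) (hostSliceOfDiffeo Φ q) y w] ≠ 0) ∧
      Manifold.IsSmoothEmbedding (𝓡 2) (𝓡 4) ∞ (hostSliceOfDiffeo Φ q') ∧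
      Disjoint (Set.range (hostSliceOfDiffeo Φ q)) (Set.range (hostSliceOfDiffeo Φ q')) ∧
      ∃ H : unitInterval × 𝕊² → X, Continuous H ∧
        ∀ y, H (0, y) = hostSliceOfDiffeo Φ q y ∧ H (1, y) = hostSliceOfDiffeo Φ q' y) :=
  ⟨hostFormOfDiffeo_isSymplectic Φ,
    isSmoothEmbedding_hostSliceOfDiffeo Φ q, hostFormOfDiffeo_hostSlice_nondegenerate Φ q,
    isSmoothEmbedding_hostSliceOfDiffeo Φ q', disjoint_range_hostSliceOfDiffeo Φ hq,
    exists_homotopy_hostSliceOfDiffeo Φ q q'⟩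

end Host

/-! ### The model: `S² × S²` re-charted on `ℝ⁴` -/

section Model

/-- The `Fact` instance feeding Mathlib's sphere API for `S² ⊂ ℝ³`. [folklore] -/
private theorem fact_finrank_three_model : Fact (Module.finrank ℝ (𝔼 3) = 2 + 1) :=
  ⟨finrank_euclideanSpace_fin⟩

attribute [local instance] fact_finrank_three_model

/-- The change of model `ℝ² × ℝ² ≃L ℝ⁴` (a linear isomorphism chosen by dimension count,
Mathlib's `ContinuousLinearEquiv.ofFinrankEq`). [folklore] -/
def modelEquivFour : (𝔼 2 × 𝔼 2) ≃L[ℝ] 𝔼 4 :=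
  ContinuousLinearEquiv.ofFinrankEq (by simp)

/-- The change of model as a homeomorphism `ModelProd ℝ² ℝ² ≃ₜ ℝ⁴`. [folklore] -/
def modelHomeoFour : ModelProd (𝔼 2) (𝔼 2) ≃ₜ 𝔼 4 :=
  modelEquivFour.toHomeomorph

/-- `modelHomeoFour` is `modelEquivFour` read through the model with corners
`(𝓡 2).prod (𝓡 2)` (definitional). [folklore] -/
theorem modelHomeoFour_apply (x : ModelProd (𝔼 2) (𝔼 2)) :
    modelHomeoFour x = modelEquivFour (((𝓡 2).prod (𝓡 2)) x) := rfl

/-- **`S² × S²` charted on `ℝ⁴`**: Mathlib's product manifold `S² × S²` (charts valued in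
`ModelProd ℝ² ℝ²`) re-charted along `ℝ² × ℝ² ≃L ℝ⁴` by the tree's `Rechart` (Lee 2013,
Prop. 1.17: a compatible atlas on the same space). [cite: LeeSmoothManifolds2013, Prop. 1.17] -/
abbrev SphereProdFour : Type :=
  Literature.Geometry.Manifold.Rechart modelHomeoFour (𝕊² × 𝕊²)

/-- `S² × S²` charted on `ℝ⁴` is second countable (same topology as `S² × S²`). [folklore] -/
instance SphereProdFour.instSecondCountableTopology : SecondCountableTopology SphereProdFour :=
  inferInstanceAs (SecondCountableTopology (𝕊² × 𝕊²))

/-- `S² × S²` charted on `ℝ⁴` is simply connected (tree theorem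
`SphereProd.simplyConnectedSpace`). [folklore] -/
instance SphereProdFour.instSimplyConnectedSpace : SimplyConnectedSpace SphereProdFour :=
  haveI : SimplyConnectedSpace (𝕊² × 𝕊²) :=
    Literature.Topology.FourManifolds.SphereProd.simplyConnectedSpace (k := 2) le_rfl
  inferInstanceAs (SimplyConnectedSpace (𝕊² × 𝕊²))

/-- The change of model is `C^∞`. [folklore] -/
theorem contMDiff_modelHomeoFour :
    ContMDiff ((𝓡 2).prod (𝓡 2)) 𝓘(ℝ, 𝔼 4) ∞ modelHomeoFour :=
  Literature.Geometry.Manifold.Rechart.contMDiff_of_apply_eq_linear (I := (𝓡 2).prod (𝓡 2))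
    modelHomeoFour modelEquivFour modelHomeoFour_apply

/-- The inverse change of model is `C^∞`. [folklore] -/
theorem contMDiff_modelHomeoFour_symm :
    ContMDiff 𝓘(ℝ, 𝔼 4) ((𝓡 2).prod (𝓡 2)) ∞ modelHomeoFour.symm :=
  Literature.Geometry.Manifold.Rechart.contMDiff_symm_of_apply_eq_linear (I := (𝓡 2).prod (𝓡 2))
    modelHomeoFour modelEquivFour modelHomeoFour_apply

/-- **`S² × S²` charted on `ℝ⁴` is a `C^∞` manifold for `𝓡 4`** (`Rechart.isManifold`).
[cite: LeeSmoothManifolds2013, Prop. 1.17] -/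
instance SphereProdFour.instIsManifold : IsManifold (𝓡 4) ∞ SphereProdFour :=
  Literature.Geometry.Manifold.Rechart.isManifold modelHomeoFour (𝕊² × 𝕊²)
    contMDiff_modelHomeoFour contMDiff_modelHomeoFour_symm

/-- **The identity diffeomorphism `SphereProdFour ≅ S² × S²`** (`Rechart.out`, `Rechart.into`,
`C^∞` in both directions: `Rechart.contMDiff_out`, `Rechart.contMDiff_into`).
[cite: LeeSmoothManifolds2013, Prop. 1.17] -/
def sphereProdFourDiffeo : SphereProdFour ≃ₘ⟮𝓡 4, (𝓡 2).prod (𝓡 2)⟯ (𝕊² × 𝕊²) where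
  toFun := Literature.Geometry.Manifold.Rechart.out modelHomeoFour (𝕊² × 𝕊²)
  invFun := Literature.Geometry.Manifold.Rechart.into modelHomeoFour (𝕊² × 𝕊²)
  left_inv := fun _ => rfl
  right_inv := fun _ => rfl
  contMDiff_toFun := Literature.Geometry.Manifold.Rechart.contMDiff_out modelHomeoFour (𝕊² × 𝕊²)
    contMDiff_modelHomeoFour contMDiff_modelHomeoFour_symm
  contMDiff_invFun := Literature.Geometry.Manifold.Rechart.contMDiff_into modelHomeoFour (𝕊² × 𝕊²)
    contMDiff_modelHomeoFour contMDiff_modelHomeoFour_symm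

/-- `SphereProdFour` is homeomorphic to `S² × S²` (the identity). [folklore] -/
def sphereProdFourHomeomorph : SphereProdFour ≃ₜ (𝕊² × 𝕊²) :=
  Literature.Geometry.Manifold.Rechart.outHomeomorph modelHomeoFour (𝕊² × 𝕊²)

/-- The symplectic form `σ ⊕ σ` of `S² × S²` charted on `ℝ⁴`.
[cite: McDuffSalamon2017, §3.1 p. 106; Example 10.4.2 (iii)] -/
def sphereProdFourForm : MForm (𝓡 4) SphereProdFour ℝ 2 :=
  hostFormOfDiffeo sphereProdFourDiffeo

/-- The horizontal slice `S² × {q}` of `S² × S²` charted on `ℝ⁴`. [folklore] -/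
def sphereProdFourSlice (q : 𝕊²) : 𝕊² → SphereProdFour :=
  hostSliceOfDiffeo sphereProdFourDiffeo q

/-- **`(S² × S², σ ⊕ σ)` charted on `ℝ⁴` is a closed simply connected symplectic 4-manifold with a
square-zero symplectic sphere pair**: `σ ⊕ σ` is smooth, closed and non-degenerate, and for
`q ≠ q'` the slices `S² × {q}`, `S² × {q'}` are smooth embeddings, the first symplectic, with
disjoint images, and homotopic (McDuff–Salamon 2017, Example 10.4.2 (iii), Example 13.4.2).
[cite: McDuffSalamon2017, Example 10.4.2 (iii); Example 13.4.2] -/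
theorem sphereProdFour_hostPackage {q q' : 𝕊²} (hq : q ≠ q') :
    (IsSmoothForm sphereProdFourForm ∧ IsClosedForm sphereProdFourForm ∧
      ∀ x (v : TangentSpace (𝓡 4) x), v ≠ 0 →
        ∃ w : TangentSpace (𝓡 4) x, sphereProdFourForm x ![v, w] ≠ 0) ∧
    (Manifold.IsSmoothEmbedding (𝓡 2) (𝓡 4) ∞ (sphereProdFourSlice q) ∧
      (∀ y (v : TangentSpace (𝓡 2) y), v ≠ 0 → ∃ w : TangentSpace (𝓡 2) y,
        sphereProdFourForm (sphereProdFourSlice q y)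
          ![mfderiv (𝓡 2) (𝓡 4) (sphereProdFourSlice q) y v,
            mfderiv (𝓡 2) (𝓡 4) (sphereProdFourSlice q) y w] ≠ 0) ∧
      Manifold.IsSmoothEmbedding (𝓡 2) (𝓡 4) ∞ (sphereProdFourSlice q') ∧
      Disjoint (Set.range (sphereProdFourSlice q)) (Set.range (sphereProdFourSlice q')) ∧
      ∃ H : unitInterval × 𝕊² → SphereProdFour, Continuous H ∧
        ∀ y, H (0, y) = sphereProdFourSlice q y ∧ H (1, y) = sphereProdFourSlice q' y) :=
  sphereProd_hostPackage_of_diffeomorph sphereProdFourDiffeo hq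

end Model

end Literature.Geometry.Symplectic

end
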